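import Summits.Ventures.HodgeRepro2.T5SU11LegendreLogConvex
import Summits.Ventures.HodgeRepro2.T5SU11LegendreSummary

/-!
# The ratio limit `P_{n+1}(x)/P_n(x) → ρ(x) = x + √(x² − 1)` and, on the group, `φ_{2n+4}(g)/φ_{2n+2}(g) → (|a| + |b|)²`

Three facts already on the tree combine into the limit of the ratios of consecutive Legendre polynomials on `[1, ∞)`:
the ratios `r_n = P_{n+1}(x)/P_n(x)` are MONOTONE in `n` (`T5SU11LegendreLogConvex.legP_ratio_mono`, from
log-convexity), the upper bound `P_n(x) ≤ ρ(x)ⁿ` (`T5SU11LegendreGenerating.legP_le_rho_pow`) and the lower bound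
`P_n(x) ≥ a_n ρ(x)ⁿ ≥ ρ(x)ⁿ/(2n + 1)` (Heine's expansion, `T5SU11LegendreHeine.exp_neg_mul_legP_cosh_sub_le`; the
crude bound `a_n ≥ 1/(2n + 1)`, `binomHalf_ge`). A monotone sequence has a limit `L`; `L > ρ` would make `P_n` grow
faster than `ρⁿ` (`legP_ratio_le_rho`), `L < ρ` would make it grow slower than `ρⁿ/(2n + 1)`; hence

  **`P_{n+1}(x)/P_n(x) → ρ(x)`**   (`tendsto_legP_ratio`),

and on the group **`φ_{2n+4}(g)/φ_{2n+2}(g) → (|a(g)| + |b(g)|)²`** (`tendsto_sph_even_ratio`): the growth rate of the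
spherical functions of even parameter in the parameter is the square of the Cartan radius `e^{t(g)} = |a| + |b|`.
Nothing is claimed about (N).

Blind lane: Mathlib + the HodgeRepro2 prefix only; no sorry; axioms ⊆ {propext, Classical.choice,
Quot.sound}.
-/

namespace Summit.Ventures.HodgeRepro2.T5SU11LegendreRatioLimit

open MeasureTheory Metric Set Filter Topology Finset
open T5SU11Unimodular T5SU11Cartan T5BergmanCoefficient T5SU11SphericalFunction T5SU11SphericalLegendre
  T5SU11SphericalLegendreAll T5SU11SphericalLegendreLaplace T5SU11LegendreGenerating T5SU11LegendreHeine
  T5SU11LegendreLogConvex T5SU11LegendreSummary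

/-! ### The crude lower bound `a_n ≥ 1/(2n + 1)` and `P_n(x) ≥ ρ(x)ⁿ/(2n + 1)` -/

/-- `a_n ≥ 1/(2n + 1)`. -/
theorem binomHalf_ge (n : ℕ) : 1 / (2 * (n : ℝ) + 1) ≤ binomHalf n := by
  induction n with
  | zero => simp
  | succ n ih =>
    have h := binomHalf_succ n
    have hn : (0 : ℝ) ≤ n := Nat.cast_nonneg n
    have hpos : 0 < (n : ℝ) + 1 := by positivity
    have e : binomHalf (n + 1) = ((n : ℝ) + 1 / 2) * binomHalf n / ((n : ℝ) + 1) := by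
      rw [eq_div_iff hpos.ne']
      linarith [h]
    rw [e]
    push_cast
    rw [le_div_iff₀ hpos]
    have h1 : 1 / (2 * ((n : ℝ) + 1) + 1) * ((n : ℝ) + 1) ≤ 1 / 2 := by
      rw [div_mul_eq_mul_div, div_le_div_iff₀ (by positivity) (by norm_num)]
      nlinarith
    have h2 : (1 : ℝ) / 2 ≤ ((n : ℝ) + 1 / 2) * binomHalf n := by
      calc (1 : ℝ) / 2 = ((n : ℝ) + 1 / 2) * (1 / (2 * (n : ℝ) + 1)) := by
            field_simp
        _ ≤ ((n : ℝ) + 1 / 2) * binomHalf n := mul_le_mul_of_nonneg_left ih (by positivity)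
    linarith

/-- **`P_n(x) ≥ a_n ρ(x)ⁿ`** for `x ≥ 1`, from Heine's expansion. -/
theorem binomHalf_mul_rho_pow_le_legP (n : ℕ) {x : ℝ} (hx : 1 ≤ x) : binomHalf n * rho x ^ n ≤ legP n x := by
  obtain ⟨t, ht0, ht⟩ := exists_cosh_two_mul_eq hx
  rw [← ht, rho_cosh ht0]
  have h := (exp_neg_mul_legP_cosh_sub_le n ht0).1
  have hpos : 0 < Real.exp (-(2 * (n : ℝ)) * t) := Real.exp_pos _
  have e : Real.exp (2 * t) ^ n = (Real.exp (-(2 * (n : ℝ)) * t))⁻¹ := by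
    rw [← Real.exp_nat_mul, ← Real.exp_neg]
    congr 1
    ring
  rw [e, ← div_eq_mul_inv, div_le_iff₀ hpos]
  linarith

/-- **`P_n(x) ≥ ρ(x)ⁿ/(2n + 1)`** for `x ≥ 1`. -/
theorem rho_pow_div_le_legP (n : ℕ) {x : ℝ} (hx : 1 ≤ x) : rho x ^ n / (2 * (n : ℝ) + 1) ≤ legP n x := by
  have h1 := binomHalf_ge n
  have h2 := binomHalf_mul_rho_pow_le_legP n hx
  have hρ : 0 ≤ rho x ^ n := pow_nonneg (rho_pos hx).le n
  calc rho x ^ n / (2 * (n : ℝ) + 1) = 1 / (2 * (n : ℝ) + 1) * rho x ^ n := by ring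
    _ ≤ binomHalf n * rho x ^ n := mul_le_mul_of_nonneg_right h1 hρ
    _ ≤ legP n x := h2

/-! ### The ratios are bounded by `ρ` -/

/-- `P_{N+m}(x) ≥ P_N(x) · r_N^m` when the ratios are monotone. -/
theorem legP_add_ge (N m : ℕ) {x : ℝ} (hx : 1 ≤ x) :
    legP N x * (legP (N + 1) x / legP N x) ^ m ≤ legP (N + m) x := by
  induction m with
  | zero => simp
  | succ m ih =>
    have hr : legP (N + 1) x / legP N x ≤ legP (N + m + 1) x / legP (N + m) x := by
      letI : MeasurableSpace Circle := borel Circle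
      haveI : BorelSpace Circle := ⟨rfl⟩
      have hmono : Monotone fun n => legP (n + 1) x / legP n x :=
        monotone_nat_of_le_succ fun n => legP_ratio_mono n hx
      exact hmono (Nat.le_add_right N m)
    have hpos : 0 < legP (N + m) x := by linarith [one_le_legP' (N + m) hx]
    have hr0 : 0 ≤ legP (N + 1) x / legP N x := by
      have := one_le_legP' (N + 1) hx; have := one_le_legP' N hx; positivity
    have hN : 0 ≤ legP N x := by linarith [one_le_legP' N hx]
    calc legP N x * (legP (N + 1) x / legP N x) ^ (m + 1)
        = (legP N x * (legP (N + 1) x / legP N x) ^ m) * (legP (N + 1) x / legP N x) := by ring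
      _ ≤ legP (N + m) x * (legP (N + m + 1) x / legP (N + m) x) :=
          mul_le_mul ih hr hr0 hpos.le
      _ = legP (N + m + 1) x := by field_simp

/-- **`P_{n+1}(x)/P_n(x) ≤ ρ(x)`** for every `n` and `x ≥ 1`. -/
theorem legP_ratio_le_rho (n : ℕ) {x : ℝ} (hx : 1 ≤ x) : legP (n + 1) x / legP n x ≤ rho x := by
  by_contra hcon
  rw [not_le] at hcon
  have hρ := rho_pos hx
  have hq : 1 < legP (n + 1) x / legP n x / rho x := by rwa [one_lt_div hρ]
  have hN : 0 < legP n x := by linarith [one_le_legP' n hx]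
  -- `(r_n/ρ)^m ≤ ρⁿ/P_n` for every `m`, contradicting `(r_n/ρ)^m → ∞`
  have hbound : ∀ m : ℕ, (legP (n + 1) x / legP n x / rho x) ^ m ≤ rho x ^ n / legP n x := fun m => by
    have h1 := legP_add_ge n m hx
    have h2 := legP_le_rho_pow (n + m) hx
    have h3 : legP n x * (legP (n + 1) x / legP n x) ^ m ≤ rho x ^ n * rho x ^ m := by
      rw [← pow_add]
      exact h1.trans h2
    rw [div_pow, div_le_div_iff₀ (pow_pos hρ m) hN]
    calc (legP (n + 1) x / legP n x) ^ m * legP n x = legP n x * (legP (n + 1) x / legP n x) ^ m := mul_comm _ _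
      _ ≤ rho x ^ n * rho x ^ m := h3
  have hlim := tendsto_pow_atTop_atTop_of_one_lt hq
  obtain ⟨m, hm⟩ := (hlim.eventually_gt_atTop (rho x ^ n / legP n x)).exists
  linarith [hbound m]

/-! ### The limit -/

/-- **`P_{n+1}(x)/P_n(x) → ρ(x)`** as `n → ∞`, for every `x ≥ 1`. -/
theorem tendsto_legP_ratio {x : ℝ} (hx : 1 ≤ x) :
    Tendsto (fun n : ℕ => legP (n + 1) x / legP n x) atTop (𝓝 (rho x)) := by
  letI : MeasurableSpace Circle := borel Circle
  haveI : BorelSpace Circle := ⟨rfl⟩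
  set r : ℕ → ℝ := fun n => legP (n + 1) x / legP n x with hr
  have hmono : Monotone r := monotone_nat_of_le_succ fun n => legP_ratio_mono n hx
  have hbdd : BddAbove (Set.range r) := ⟨rho x, by
    rintro _ ⟨n, rfl⟩
    exact legP_ratio_le_rho n hx⟩
  have hlim : Tendsto r atTop (𝓝 (⨆ n, r n)) := tendsto_atTop_ciSup hmono hbdd
  have hL_le : (⨆ n, r n) ≤ rho x := ciSup_le fun n => legP_ratio_le_rho n hx
  have hL_ge : rho x ≤ ⨆ n, r n := by
    by_contra hcon
    rw [not_le] at hcon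
    set L := ⨆ n, r n with hL
    have hL0 : 0 ≤ L := le_trans (by
      have := one_le_legP' 1 hx
      have h0 : r 0 = legP 1 x / legP 0 x := rfl
      rw [legP_zero, div_one] at h0
      rw [← h0] at this
      exact zero_le_one.trans this) (le_ciSup hbdd 0)
    have hρ := rho_pos hx
    -- `P_n ≤ Lⁿ`
    have hup : ∀ n, legP n x ≤ L ^ n := fun n => by
      induction n with
      | zero => simp
      | succ n ih =>
        have hrn : r n ≤ L := le_ciSup hbdd n
        have hPn : 0 < legP n x := by linarith [one_le_legP' n hx]
        have e : legP (n + 1) x = r n * legP n x := by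
          simp only [hr]
          field_simp
        rw [e, pow_succ]
        have := one_le_legP' n hx
        nlinarith [mul_le_mul hrn ih hPn.le hL0]
    -- hence `1 ≤ (2n + 1) (L/ρ)ⁿ`, contradicting `n (L/ρ)ⁿ → 0`
    have hq0 : 0 ≤ L / rho x := div_nonneg hL0 hρ.le
    have hq1 : L / rho x < 1 := by rwa [div_lt_one hρ]
    have hkey : ∀ n : ℕ, 1 ≤ (2 * (n : ℝ) + 1) * (L / rho x) ^ n := fun n => by
      have h1 := rho_pow_div_le_legP n hx
      have h2 := hup n
      have hρn : 0 < rho x ^ n := pow_pos hρ n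
      rw [div_pow]
      rw [div_le_iff₀ (by positivity)] at h1
      calc (1 : ℝ) = rho x ^ n / rho x ^ n := (div_self hρn.ne').symm
        _ ≤ (2 * (n : ℝ) + 1) * L ^ n / rho x ^ n := by
            rw [div_le_div_iff_of_pos_right hρn]
            nlinarith [h1.trans (mul_le_mul_of_nonneg_right h2 (by positivity : (0 : ℝ) ≤ 2 * (n : ℝ) + 1))]
        _ = (2 * (n : ℝ) + 1) * (L ^ n / rho x ^ n) := by ring
    have hlim2 : Tendsto (fun n : ℕ => (2 * (n : ℝ) + 1) * (L / rho x) ^ n) atTop (𝓝 0) := by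
      have h1 := (tendsto_self_mul_const_pow_of_lt_one hq0 hq1).const_mul 2
      have h2 := tendsto_pow_atTop_nhds_zero_of_lt_one hq0 hq1
      have := h1.add h2
      simp only [mul_zero, add_zero] at this
      refine this.congr fun n => ?_
      ring
    obtain ⟨n, hn⟩ := (hlim2.eventually_lt_const (show (0 : ℝ) < 1 by norm_num)).exists
    linarith [hkey n]
  rw [le_antisymm hL_le hL_ge] at hlim
  exact hlim

section measure

variable [MeasurableSpace Circle] [BorelSpace Circle]

/-- **`φ_{2n+4}(g)/φ_{2n+2}(g) → (|a(g)| + |b(g)|)²`** as `n → ∞`, for every `g`. -/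
theorem tendsto_sph_even_ratio (g : SU11) :
    Tendsto (fun n : ℕ => sph (2 * ((n : ℝ) + 1) + 2) g / sph (2 * (n : ℝ) + 2) g) atTop
      (𝓝 ((‖mat g 0 0‖ + ‖mat g 0 1‖) ^ 2)) := by
  have e : ∀ n : ℕ, sph (2 * ((n : ℝ) + 1) + 2) g / sph (2 * (n : ℝ) + 2) g
      = legP (n + 1) (sph 4 g) / legP n (sph 4 g) := fun n => by
    have h1 := sph_even_eq_sph_four (n + 1) g
    push_cast at h1
    rw [h1, sph_even_eq_sph_four]
  simp only [e]
  rw [← rho_sph_four]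
  exact tendsto_legP_ratio (one_le_sph_four g)

end measure

end Summit.Ventures.HodgeRepro2.T5SU11LegendreRatioLimit
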